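import Summits.HodgeConjecture.HodgeConjecture.Theses.AnchorTransport
import Summits.HodgeConjecture.HodgeConjecture.Theorems.AnchorTransportTargetIffHodgeConjecture
import Summits.HodgeConjecture.HodgeConjecture.Theorems.AnchorTransportAnchorExistenceFloor
import Literature.AlgebraicGeometry.Motives.VarietiesProjectiveSpaceProofs
import Literature.AlgebraicGeometry.Motives.ProjectiveSpaceFieldPointsBijective

/-!
# `AnchorExistence` (stmt-HodgeConjecture-1077) · Negative · the isotrivial strengthening is HC-sandwiched

Negative knowledge for the crux `AnchorTransport.AnchorExistence` (route AnchorTransport, rank 3), from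
the standing disprover's work file `Cruxes/AnchorExistence/Disproof.lean` (§3).  The crux is implied by
the Hodge conjecture through the CONSTANT family over `Spec ℂ` (`s₁ = s₀`).  One might hope to give it
content separable from HC by forbidding that witness — asking for `s₁ ≠ s₀`, i.e. a positive-dimensional
base.  This file shows the hope is void: the strengthened statement is STILL a consequence of the Hodge
conjecture, through the ISOTRIVIAL family `X × ℙ¹ ⟶ ℙ¹` (`anchor_trivialFamily_of_mem_algebraicClasses`,
`anchorExistence_distinct_of_hodgeConjecture`), so it stays sandwiched `HC → An⁺ → An →(V) HC`.
Together with the prover's `anchorTransport_mem_algebraicClasses_of_anchor_of_fiberIso` (an anchor fibre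
compatibly isomorphic to `X` gives nothing) this pins the crux's separable content to anchors whose fibre
is NOT compatibly isomorphic to `X` — the geography of Hodge loci — which must be typed through the
isomorphism type of `𝒳_{s₀}`, not through the position of `s₀`.
Refuter seat refuter-cdisprove-stmt-HodgeConjecture-1077-0 (cdisprove cycle 1), 2026-08-16.
-/

noncomputable section

-- The mandated namespace `Summit.<P>.<Sub>.Theorems.…` repeats `HodgeConjecture` (single-conjunct summit).
set_option linter.dupNamespace false

namespace Summit.HodgeConjecture.HodgeConjecture.Theorems.AnchorExistence.Negative.IsotrivialStrengthening

open CategoryTheory AlgebraicGeometry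
open Literature.AlgebraicGeometry Literature.AlgebraicGeometry.Motives
  Literature.AlgebraicGeometry.HodgeTheory Literature.AlgebraicTopology.SingularHomology

/-- Two distinct complex points of `ℙ¹_ℂ`: `[1 : 0] ≠ [1 : 1]` (homogeneous coordinates are unique up
to `ℂˣ`, `ProjectiveSpace.pointOfVec_eq_pointOfVec_iff`). [cite: Hartshorne1977, II Ex. 2.14] -/
theorem exists_ne_complexPoints_projectiveLine :
    ∃ t₁ t₀ : ComplexPoints (projectiveSpace 1 ℂ), t₁ ≠ t₀ := by
  have h10 : (![1, 0] : Fin 2 → ℂ) ≠ 0 := fun h ↦ by simpa using congr_fun h 0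
  have h11 : (![1, 1] : Fin 2 → ℂ) ≠ 0 := fun h ↦ by simpa using congr_fun h 0
  refine ⟨ProjectiveSpace.pointOfVec ℂ ![1, 0] h10, ProjectiveSpace.pointOfVec ℂ ![1, 1] h11,
    fun hab ↦ ?_⟩
  obtain ⟨r, -, h⟩ := (ProjectiveSpace.pointOfVec_eq_pointOfVec_iff _ _ _ _).mp hab
  have h0 := congr_fun h 0
  have h1 := congr_fun h 1
  simp only [Pi.smul_apply, smul_eq_mul, Matrix.cons_val_zero, Matrix.cons_val_one,
    mul_one, mul_zero] at h0 h1
  exact one_ne_zero h1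

/-- **The isotrivial anchor `X × T ⟶ T`.** If `c` is ALREADY algebraic on the smooth projective `X`,
then for every smooth irreducible `ℂ`-scheme `T` and points `t₁, t₀ ∈ T(ℂ)` the trivial family
`X × T ⟶ T` (base change `Motives.familyPullback` of the constant family `X ⟶ Spec ℂ` along
`T ⟶ Spec ℂ`; smooth projective by `IsSmoothProjectiveFamily.familyPullback_snd`) with the class
`pr₁^* c` is an anchor datum for `(X, c)` at `(t₁, t₀)`: its fibres are `X`
(`fiberOverFamilyPullbackIso`, `isIso_fiberι_toSpecOver`), the fibre restrictions of `pr₁^* c` are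
transports of `c` along these isos (`anchorTransport_map_fiberι_familyPullback`), hence rational, of type
`(p,p)`, equal to `c` at `t₁` through the fibre iso and algebraic at `t₀` (the route's proved
`IsoInvariance`). [cite: Hartshorne1977, II.3 p. 89] [cite: VoisinHodgeI2002, §7.3.2 and §9.1.1] -/
theorem anchor_trivialFamily_of_mem_algebraicClasses {n p : ℕ} {X : SchemeOver ℂ}
    (hX : IsSmoothProjective n X) {c : complexBetti X (2 * p)} (hc : IsRationalClass c)
    (hpp : IsOfHodgeType n X (2 * p) p p c) (halg : c ∈ algebraicClasses X p)
    (T : SchemeOver ℂ) (t₁ t₀ : ComplexPoints T) :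
    ∃ (e : X ≅ fiberOver (familyPullback.snd (toSpecOver X) (toSpecOver T)) t₁)
      (A : complexBetti (familyPullback (toSpecOver X) (toSpecOver T)) (2 * p)),
      IsSmoothProjectiveFamily (familyPullback.snd (toSpecOver X) (toSpecOver T)) n ∧
      (∀ s : ComplexPoints T,
        IsRationalClass (complexBetti.map (fiberι (familyPullback.snd (toSpecOver X) (toSpecOver T)) s)
          (2 * p) A) ∧
        IsOfHodgeType n (fiberOver (familyPullback.snd (toSpecOver X) (toSpecOver T)) s) (2 * p) p p
          (complexBetti.map (fiberι (familyPullback.snd (toSpecOver X) (toSpecOver T)) s) (2 * p) A)) ∧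
      complexBetti.map e.hom (2 * p)
          (complexBetti.map (fiberι (familyPullback.snd (toSpecOver X) (toSpecOver T)) t₁) (2 * p) A) =
        c ∧
      complexBetti.map (fiberι (familyPullback.snd (toSpecOver X) (toSpecOver T)) t₀) (2 * p) A ∈
        algebraicClasses (fiberOver (familyPullback.snd (toSpecOver X) (toSpecOver T)) t₀) p := by
  haveI : ∀ s : AlgPoints (specOver ℂ ℂ) ℂ, IsIso (fiberι (toSpecOver X) s) := isIso_fiberι_toSpecOver
  set f := toSpecOver X with hf_def
  set g := toSpecOver T with hg_def
  -- the fibre isos `X_{g(t)} ≅ X` of the constant family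
  let ι : ∀ t : ComplexPoints T, fiberOver f (AlgPoints.map g t) ≅ X :=
    fun t ↦ asIso (fiberι (toSpecOver X) (AlgPoints.map g t))
  have hfam : IsSmoothProjectiveFamily f n := isSmoothProjectiveFamily_toSpecOver hX
  refine ⟨(ι t₁).symm ≪≫ (fiberOverFamilyPullbackIso f g t₁).symm,
    complexBetti.map (familyPullback.fst f g) (2 * p) c, hfam.familyPullback_snd g, fun s ↦ ?_, ?_, ?_⟩
  · -- fibrewise rational and of type `(p,p)`
    rw [anchorTransport_map_fiberι_familyPullback]
    exact ⟨(hc.pullback _).pullback _,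
      (hpp.map_of_iso (ι s)).map_of_iso (fiberOverFamilyPullbackIso f g s)⟩
  · -- at `t₁`: `e^* ((pr₁^* c)|_{t₁}) = c`
    rw [anchorTransport_map_fiberι_familyPullback, Iso.trans_hom, Iso.symm_hom, Iso.symm_hom,
      complexBetti.map_comp]
    change complexBetti.map (ι t₁).inv (2 * p)
        ((complexBetti.map (fiberOverFamilyPullbackIso f g t₁).hom (2 * p) ≫
          complexBetti.map (fiberOverFamilyPullbackIso f g t₁).inv (2 * p))
          (complexBetti.map (fiberι f (AlgPoints.map g t₁)) (2 * p) c)) = c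
    rw [← complexBetti.map_comp, Iso.inv_hom_id, complexBetti.map_id]
    change (complexBetti.map (ι t₁).hom (2 * p) ≫ complexBetti.map (ι t₁).inv (2 * p)) c = c
    rw [← complexBetti.map_comp, Iso.inv_hom_id, complexBetti.map_id]
    rfl
  · -- at `t₀`: algebraic, by transport along the two isos
    rw [anchorTransport_map_fiberι_familyPullback]
    exact anchorTransport_isoInvariance_proof (fiberOverFamilyPullbackIso f g t₀) p _
      (anchorTransport_isoInvariance_proof (ι t₀) p _ halg)

/-- **`HodgeConjecture` implies the crux STRENGTHENED by `s₁ ≠ s₀`.** The statement below is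
`AnchorExistence` with `s₁ ≠ s₀` added to the conclusion (the constant family over `Spec ℂ` is no
longer a witness; the base is positive-dimensional).  Under HC every rational `(p,p)` class is
algebraic, hence anchored at a DIFFERENT point of the smooth irreducible base `ℙ¹_ℂ` by the isotrivial
family `X × ℙ¹ ⟶ ℙ¹` (`anchor_trivialFamily_of_mem_algebraicClasses`, points
`exists_ne_complexPoints_projectiveLine`).  So this strengthening is still HC-sandwiched and cannot be
refuted short of `¬ HodgeConjecture` either. [cite: CharlesSchnell2014Notes, Conj. 11.3.1]
[cite: VoisinHodgeI2002, §9.1.1] -/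
theorem anchorExistence_distinct_of_hodgeConjecture (hHC : _root_.HodgeConjecture) :
    ∀ ⦃n : ℕ⦄ ⦃X : SchemeOver ℂ⦄, IsSmoothProjective n X →
      ∀ (p : ℕ) (c : complexBetti X (2 * p)), IsRationalClass c → IsOfHodgeType n X (2 * p) p p c →
        ∃ (𝒳 S : SchemeOver ℂ) (f : 𝒳 ⟶ S) (s₁ s₀ : ComplexPoints S) (e : X ≅ fiberOver f s₁)
          (A : complexBetti 𝒳 (2 * p)),
          s₁ ≠ s₀ ∧ IsSmoothProjectiveFamily f n ∧ IrreducibleSpace S.left ∧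
          AlgebraicGeometry.Smooth S.hom ∧
          (∀ s : ComplexPoints S, IsRationalClass (complexBetti.map (fiberι f s) (2 * p) A) ∧
            IsOfHodgeType n (fiberOver f s) (2 * p) p p (complexBetti.map (fiberι f s) (2 * p) A)) ∧
          complexBetti.map e.hom (2 * p) (complexBetti.map (fiberι f s₁) (2 * p) A) = c ∧
          complexBetti.map (fiberι f s₀) (2 * p) A ∈ algebraicClasses (fiberOver f s₀) p := by
  intro n X hX p c hc hpp
  have halg : c ∈ algebraicClasses X p := (hHC hX).2 p c hc hpp
  have hT : IsSmoothProjective 1 (projectiveSpace 1 ℂ) := isSmoothProjective_projectiveSpace_holds ℂ 1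
  haveI := hT.smoothOfRelativeDimension
  haveI := hT.geometricallyIrreducible
  have hirr : IrreducibleSpace (projectiveSpace 1 ℂ).left :=
    GeometricallyIrreducible.irreducibleSpace_of_subsingleton (projectiveSpace 1 ℂ).hom
  have hsm : AlgebraicGeometry.Smooth (projectiveSpace 1 ℂ).hom := SmoothOfRelativeDimension.smooth 1 _
  obtain ⟨t₁, t₀, ht⟩ := exists_ne_complexPoints_projectiveLine
  obtain ⟨e, A, hf, hfib, hAc, hs₀⟩ :=
    anchor_trivialFamily_of_mem_algebraicClasses hX hc hpp halg (projectiveSpace 1 ℂ) t₁ t₀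
  exact ⟨_, _, _, t₁, t₀, e, A, ht, hf, hirr, hsm, hfib, hAc, hs₀⟩

end Summit.HodgeConjecture.HodgeConjecture.Theorems.AnchorExistence.Negative.IsotrivialStrengthening

end
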